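import Summits.BirchSwinnertonDyer.Rank1Residual.X2.TrivialZeroQuotientCorank
import Summits.BirchSwinnertonDyer.Rank1Residual.X2.NonPrimitiveLambdaInvariantMultiplicativeOfDatum
import Summits.BirchSwinnertonDyer.Rank1Residual.X2.NonPrimitiveSelmerDual
import Literature.NumberTheory.EllipticCurves.IwasawaSelmerModuleFiniteProofs
import HarnessLib

/-!
# GV (6)–(7) at an odd SPLIT multiplicative prime from the datum record, MODULO the infinitude of
# the trivial-zero quotient `S_A(ℚ_∞)/S^{str}_A(ℚ_∞)` (the core of the derivation of A133's split half)

HONEST FRAMING (BSD rank-`≤ 1` residual cell `b2b-bsdres`, home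
`run/shared/lean/b2b/bsd-rank1-residual/`, unit `b2b-bsdres-eisenstein-p2`, class X2; research route,
no claim beyond stated classes): the cell deletes the COMBINATION-SHAPED residual classes of the
rank-`≤ 1` BSD formula from PUBLISHED theorems only and TYPES the construction-shaped ones; this is
not "finishing BSD". THEOREMS ONLY (no definition, no named fact, nothing asserted).

## What

GV pp. 14–15: "It is only when the trivial zero is included that our approach proceeds smoothly."
This file carries Greenberg–Vatsal's datum-level relations (Cor. (2.3) + Prop. (2.4), tree record
`datumSelmer_nonPrimitive_invariants`, T-GV23L) across the trivial-zero quotient to the CLASSICAL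
groups at a split prime (`Sel^{Σ₀}_E(ℚ_∞)_p = S^{Σ₀,str}_A(ℚ_∞)`, `TrivialZeroQuotientCorank` §1):

* `moduleFinite_and_isTorsion_datumDualData_empty_of_split` — the canonical dual of `S_A(ℚ_∞)` is
  finitely generated (Nakayama, `DualRestrictionSelmer.moduleFinite_datumDualData_of_finite` with
  `Sel_∞[𝔪]` finite) and torsion when `X(E/ℚ_∞)` is — i.e. Prop. (2.1)'s hypothesis
  "`S_A(ℚ_∞)` is `Λ`-cotorsion" obtained from the classical one;
* **`invariants_multiplicative_of_split_of_infinite`** — the conclusion of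
  `lambda_nonPrimitive_eq_add_sum_delta_multiplicative` (A133) at a SPLIT prime for Tate data `L`
  (`C` divisible, `#C[p] = p`, `D_v`-trivial quotient, `strictKer = localKerOver`, as supplied by
  `exists_data_of_split` from A40), from `h23` and the hypothesis `Infinite (S_A(ℚ_∞)/S^{str}_A(ℚ_∞))`
  (the record `datumStrictSelmer_relIndex_eq_zero_of_split` supplies it in the sequel):
  `λ(X^{Σ₀}) + 1 = λ(X) + 1 + Σ δ` by `DualRestrictionSelmer.invariants_of_restrictionMap` on both
  sides and `zpCorank_quotient_eq_one_of_infinite`.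

References: GV 2000 = arXiv:math/9906215 §1 (5)–(7), pp. 14–15, §2 pp. 16–22, 26; Greenberg LNM
1716 §1 p. 60, p. 93.
-/

noncomputable section

open scoped Classical AddSubgroup

universe u v

namespace Summit.BirchSwinnertonDyer.Rank1Residual.X2.NonPrimitiveLambdaInvariantSplitOfDatum

open NumberField IsDedekindDomain Field WeierstrassCurve
  Literature.NumberTheory.EllipticCurves Literature.NumberTheory.EllipticCurves.GreenbergSelmer
  Literature.NumberTheory.EllipticCurves.GreenbergVatsal2000
  Literature.NumberTheory.EllipticCurves.IwasawaDual
  Literature.NumberTheory.GaloisRepresentations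
  Summit.BirchSwinnertonDyer.Rank1Residual.X2.GreenbergVatsalTorsion
  Summit.BirchSwinnertonDyer.Rank1Residual.X2.GreenbergVatsalStrictSelmer
  Summit.BirchSwinnertonDyer.Rank1Residual.X2.GreenbergVatsalTateDatumCofree
  Summit.BirchSwinnertonDyer.Rank1Residual.X2.DualRestrictionSelmer
  Summit.BirchSwinnertonDyer.Rank1Residual.X2.TrivialZeroQuotientCorank

/-! ## §4. The split prime: GV (6)–(7) for the classical groups, modulo the trivial zero -/

section Split

variable (W : WeierstrassCurve ℚ) [W.IsElliptic] [W.IsGloballyMinimal] (p : ℕ) [hp : Fact p.Prime]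
  (κ : ZpExtension ℚ p) {γ : absoluteGaloisGroup ℚ}

omit [W.IsElliptic] [W.IsGloballyMinimal] in
/-- The strict identity `strictKer = localKerOver` above `p` from the two inclusions of
`exists_data_of_split` (Greenberg p. 76 for the Tate datum). [cite: GreenbergLNM1716, §2 p. 76] -/
theorem strictKer_eq_of_le_of_le (L : Data ℚ (W.geomPrimaryTorsion p) p)
    (hls : ∀ (v : HeightOneSpectrum (𝓞 ℚ)) (hv : ((p : ℕ) : 𝓞 ℚ) ∈ v.asIdeal),
      W.localKerOver p κ.kerSubgroup (v.adicCompletion ℚ) ≤ (L v hv).strictKer κ.kerSubgroup)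
    (hsl : ∀ (v : HeightOneSpectrum (𝓞 ℚ)) (hv : ((p : ℕ) : 𝓞 ℚ) ∈ v.asIdeal),
      (L v hv).strictKer κ.kerSubgroup ≤ W.localKerOver p κ.kerSubgroup (v.adicCompletion ℚ)) :
    ∀ (v : HeightOneSpectrum (𝓞 ℚ)) (hv : ((p : ℕ) : 𝓞 ℚ) ∈ v.asIdeal),
      (L v hv).strictKer κ.kerSubgroup = W.localKerOver p κ.kerSubgroup (v.adicCompletion ℚ) :=
  fun v hv ↦ le_antisymm (hsl v hv) (hls v hv)

omit [W.IsGloballyMinimal] in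
/-- **The canonical dual of `S_A(ℚ_∞)` is finitely generated and, if `X(E/ℚ_∞)` is torsion,
torsion** — for the Tate data at a split prime (`Sel_E(ℚ_∞)_p = S^{str}_A(ℚ_∞)`): Nakayama
(`moduleFinite_datumDualData_of_finite` with `Sel_∞[𝔪]` finite,
`finite_setOf_selmerInfty_pTorsion_conjH1_eq_of_isTopGenerator`, and `(S_A/S^{str}_A)[p]` finite) and
`isTorsion_of_restrictionMap`. These are the hypotheses "`S_A(ℚ_∞)` is `Λ`-cotorsion" of GV
Prop. (2.1) for the datum, obtained from the classical ones.
[cite: GreenbergVatsal2000, §2 pp. 14–17, 26] [cite: GreenbergLNM1716, §1 p. 60] -/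
theorem moduleFinite_and_isTorsion_datumDualData_empty_of_split (hp2 : p ≠ 2) (hκ : κ.IsCyclotomic)
    (hγ : κ.IsTopGenerator γ) (L : Data ℚ (W.geomPrimaryTorsion p) p)
    (hC : ∀ (v : HeightOneSpectrum (𝓞 ℚ)) (hv : ((p : ℕ) : 𝓞 ℚ) ∈ v.asIdeal),
      (∀ c ∈ (L v hv).plus, ∃ c' ∈ (L v hv).plus, p • c' = c) ∧
        Nat.card ↥((L v hv).plus ⊓ (↥(W.geomPrimaryTorsion p))[(p : ℤ)]) = p)
    (htrivD : ∀ (v : HeightOneSpectrum (𝓞 ℚ)) (hv : ((p : ℕ) : 𝓞 ℚ) ∈ v.asIdeal),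
      ∀ (δ : decomp (K := ℚ) v) (d : (L v hv).Gr), δ • d = d)
    (hRD : ∀ (v : HeightOneSpectrum (𝓞 ℚ)) (hv : ((p : ℕ) : 𝓞 ℚ) ∈ v.asIdeal),
      (L v hv).strictKer κ.kerSubgroup = W.localKerOver p κ.kerSubgroup (v.adicCompletion ℚ))
    (D : W.SelmerDualData κ γ) (hX : D.IsTorsion) :
    Module.Finite (IwasawaAlgebra p) (datumDualData W κ L ∅ hγ).X ∧
      Module.IsTorsion (IwasawaAlgebra p) (datumDualData W κ L ∅ hγ).X := by
  -- `Sel_∞ = S^{str} ≤ S_A`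
  have hSel : W.selmerInfty κ = gvStrictSelmerInfty κ (W.geomPrimaryTorsion p) L ∅ :=
    selmerInfty_eq_gvStrictSelmerInfty_of_strictKer_eq W p κ hp2 hκ L hRD
  have hTS : W.selmerInfty κ ≤ datumSelmerInfty κ (W.geomPrimaryTorsion p) L ∅ := by
    rw [hSel]
    exact gvStrictSelmerInfty_le_gvSelmerInfty κ _ L ∅
  have hφT : ∀ t : W.selmerInfty κ,
      ((W.conjSelmerInfty κ γ t : W.selmerInfty κ) : subgroupH1 κ.kerSubgroup (W.geomPrimaryTorsion p)) =
        conjH1 κ.kerSubgroup (W.geomPrimaryTorsion p) γ t :=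
    fun t ↦ rfl
  haveI : Finite ((↥(datumSelmerInfty κ (W.geomPrimaryTorsion p) L ∅) ⧸
      (W.selmerInfty κ).addSubgroupOf (datumSelmerInfty κ (W.geomPrimaryTorsion p) L ∅))[(p : ℤ)]) := by
    rw [hSel]
    exact (finite_torsionBy_quotient_and_zpCorank_le W p κ L ∅ hκ hC htrivD).1
  have hfinT : Set.Finite {t : W.selmerInfty κ | p • t = 0 ∧ W.conjSelmerInfty κ γ t = t} := by
    refine (W.finite_setOf_selmerInfty_pTorsion_conjH1_eq_of_isTopGenerator κ hγ).subset ?_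
    rintro t ⟨ht1, ht2⟩
    refine ⟨ht1, ?_⟩
    rw [← W.coe_conjSelmerInfty_apply κ γ t]
    exact congrArg Subtype.val ht2
  have hfg : Module.Finite (IwasawaAlgebra p) (datumDualData W κ L ∅ hγ).X :=
    moduleFinite_datumDualData_of_finite W κ hγ L ∅ hTS (W.conjSelmerInfty κ γ) hφT hfinT
  haveI := hfg
  exact ⟨hfg, isTorsion_of_restrictionMap W κ hγ L ∅ hTS (W.conjSelmerInfty κ γ) hφT
    (W.isLocNil_conjSelmerInfty_sub_one κ hγ) D.toDual D.bijective
    (fun y t ↦ D.toDual_T_smul y t) D.toDual_C_smul hX⟩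

/-- **GV (6)–(7) at an odd SPLIT `p ‖ N`, modulo the trivial zero.** For the Tate data `L` above a
split multiplicative prime (with `C` divisible, `#C[p] = p`, `D_v`-trivial quotient and
`strictKer = localKerOver`, as supplied by `exists_data_of_split` from A40), `E(ℚ_∞)[p^∞]` finite,
the datum record `h23`, and the INFINITUDE of the trivial-zero quotient `S_A(ℚ_∞)/S^{str}_A(ℚ_∞)`:
for every finite `Σ₀ ∌ p`, every f.g. torsion dual `D` of `Sel_E(ℚ_∞)_p` and every dual `DS` of
`Sel^{Σ₀}_E(ℚ_∞)_p`: `DS.X` is f.g. and torsion, `μ(DS.X) = μ(D.X)`, `λ(DS.X) = λ(D.X) + Σ δ`.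
Proof: `X(S_A) ↠ D.X` and `X(S^{Σ₀}_A) ↠ DS.X` with kernels the duals of the two trivial-zero
quotients, both of corank `1` (`DualRestrictionSelmer.invariants_of_restrictionMap`); `h23` in the
middle. [cite: GreenbergVatsal2000, §1 (5)–(7) pp. 7–8; pp. 14–15; §2 Cor. (2.3), Prop. (2.4), p. 26]
[cite: GreenbergLNM1716, §1 p. 60; p. 93] -/
theorem invariants_multiplicative_of_split_of_infinite (h23 : datumSelmer_nonPrimitive_invariants)
    (hp2 : p ≠ 2) (hκ : κ.IsCyclotomic) (hγ : κ.IsTopGenerator γ)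
    (L : Data ℚ (W.geomPrimaryTorsion p) p)
    (hC : ∀ (v : HeightOneSpectrum (𝓞 ℚ)) (hv : ((p : ℕ) : 𝓞 ℚ) ∈ v.asIdeal),
      (∀ c ∈ (L v hv).plus, ∃ c' ∈ (L v hv).plus, p • c' = c) ∧
        Nat.card ↥((L v hv).plus ⊓ (↥(W.geomPrimaryTorsion p))[(p : ℤ)]) = p)
    (htrivD : ∀ (v : HeightOneSpectrum (𝓞 ℚ)) (hv : ((p : ℕ) : 𝓞 ℚ) ∈ v.asIdeal),
      ∀ (δ : decomp (K := ℚ) v) (d : (L v hv).Gr), δ • d = d)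
    (hRD : ∀ (v : HeightOneSpectrum (𝓞 ℚ)) (hv : ((p : ℕ) : 𝓞 ℚ) ∈ v.asIdeal),
      (L v hv).strictKer κ.kerSubgroup = W.localKerOver p κ.kerSubgroup (v.adicCompletion ℚ))
    (hfix : Finite (FixedPoints.addSubgroup κ.kerSubgroup (W.geomPrimaryTorsion p)))
    [hinf : Infinite (↥(gvSelmerInfty κ (W.geomPrimaryTorsion p) L ∅) ⧸
      (gvStrictSelmerInfty κ (W.geomPrimaryTorsion p) L ∅).addSubgroupOf
        (gvSelmerInfty κ (W.geomPrimaryTorsion p) L ∅))]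
    (S₀ : Finset (HeightOneSpectrum (𝓞 ℚ))) (hS₀ : ∀ v ∈ S₀, ((p : ℕ) : 𝓞 ℚ) ∉ v.asIdeal)
    (D : W.SelmerDualData κ γ) [Module.Finite (IwasawaAlgebra p) D.X]
    (DS : NonPrimitiveDualData W κ γ (↑S₀ : Set (HeightOneSpectrum (𝓞 ℚ)))) (hX : D.IsTorsion) :
    Module.Finite (IwasawaAlgebra p) DS.X ∧ Module.IsTorsion (IwasawaAlgebra p) DS.X ∧
      muInvariant p DS.X = muInvariant p D.X ∧
      lambdaInvariant p DS.X = lambdaInvariant p D.X + ∑ v ∈ S₀, delta W p v := by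
  have hS₀' : ∀ v ∈ (↑S₀ : Set (HeightOneSpectrum (𝓞 ℚ))), ((p : ℕ) : 𝓞 ℚ) ∉ v.asIdeal :=
    fun v hv ↦ hS₀ v (Finset.mem_coe.1 hv)
  -- the classical groups are the strict datum groups
  have hSel : W.selmerInfty κ = gvStrictSelmerInfty κ (W.geomPrimaryTorsion p) L ∅ :=
    selmerInfty_eq_gvStrictSelmerInfty_of_strictKer_eq W p κ hp2 hκ L hRD
  have hNP : nonPrimitiveSelmerInfty W κ (↑S₀ : Set (HeightOneSpectrum (𝓞 ℚ))) =
      gvStrictSelmerInfty κ (W.geomPrimaryTorsion p) L ↑S₀ :=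
    nonPrimitiveSelmerInfty_eq_gvStrictSelmerInfty_of_strictKer_eq W p κ _ hp2 hκ L hRD hS₀'
  have hTS : W.selmerInfty κ ≤ datumSelmerInfty κ (W.geomPrimaryTorsion p) L ∅ := by
    rw [hSel]; exact gvStrictSelmerInfty_le_gvSelmerInfty κ _ L ∅
  have hTS₀ : nonPrimitiveSelmerInfty W κ (↑S₀ : Set (HeightOneSpectrum (𝓞 ℚ))) ≤
      datumSelmerInfty κ (W.geomPrimaryTorsion p) L ↑S₀ := by
    rw [hNP]; exact gvStrictSelmerInfty_le_gvSelmerInfty κ _ L _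
  -- finiteness of the `p`-torsion of the two trivial-zero quotients, and their coranks
  haveI : Finite ((↥(datumSelmerInfty κ (W.geomPrimaryTorsion p) L ∅) ⧸
      (W.selmerInfty κ).addSubgroupOf (datumSelmerInfty κ (W.geomPrimaryTorsion p) L ∅))[(p : ℤ)]) := by
    rw [hSel]; exact (finite_torsionBy_quotient_and_zpCorank_le W p κ L ∅ hκ hC htrivD).1
  haveI : Finite ((↥(datumSelmerInfty κ (W.geomPrimaryTorsion p) L ↑S₀) ⧸
      (nonPrimitiveSelmerInfty W κ (↑S₀ : Set (HeightOneSpectrum (𝓞 ℚ)))).addSubgroupOf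
        (datumSelmerInfty κ (W.geomPrimaryTorsion p) L ↑S₀))[(p : ℤ)]) := by
    rw [hNP]; exact (finite_torsionBy_quotient_and_zpCorank_le W p κ L _ hκ hC htrivD).1
  have hcE : zpCorank (↥(datumSelmerInfty κ (W.geomPrimaryTorsion p) L ∅) ⧸
      (W.selmerInfty κ).addSubgroupOf (datumSelmerInfty κ (W.geomPrimaryTorsion p) L ∅)) p = 1 := by
    rw [hSel]; exact zpCorank_quotient_eq_one_of_infinite W p κ L ∅ hκ hC htrivD
  haveI : Infinite (↥(gvSelmerInfty κ (W.geomPrimaryTorsion p) L ↑S₀) ⧸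
      (gvStrictSelmerInfty κ (W.geomPrimaryTorsion p) L ↑S₀).addSubgroupOf
        (gvSelmerInfty κ (W.geomPrimaryTorsion p) L ↑S₀)) :=
    infinite_quotient_mono κ (W.geomPrimaryTorsion p) L _
  have hc₀ : zpCorank (↥(datumSelmerInfty κ (W.geomPrimaryTorsion p) L ↑S₀) ⧸
      (nonPrimitiveSelmerInfty W κ (↑S₀ : Set (HeightOneSpectrum (𝓞 ℚ)))).addSubgroupOf
        (datumSelmerInfty κ (W.geomPrimaryTorsion p) L ↑S₀)) p = 1 := by
    rw [hNP]; exact zpCorank_quotient_eq_one_of_infinite W p κ L _ hκ hC htrivD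
  -- §4a: the dual of `S_A` is f.g. torsion, with `μ = μ(D)`, `λ = λ(D) + 1`
  have hφT : ∀ t : W.selmerInfty κ,
      ((W.conjSelmerInfty κ γ t : W.selmerInfty κ) : subgroupH1 κ.kerSubgroup (W.geomPrimaryTorsion p)) =
        conjH1 κ.kerSubgroup (W.geomPrimaryTorsion p) γ t :=
    fun t ↦ rfl
  obtain ⟨hfg, hXt⟩ := moduleFinite_and_isTorsion_datumDualData_empty_of_split W p κ hp2 hκ hγ L hC
    htrivD hRD D hX
  haveI := hfg
  obtain ⟨-, -, hμ, hlam⟩ := invariants_of_restrictionMap W κ hγ L ∅ hTS (W.conjSelmerInfty κ γ) hφT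
    (W.isLocNil_conjSelmerInfty_sub_one κ hγ) D.toDual D.bijective (fun y t ↦ D.toDual_T_smul y t)
    D.toDual_C_smul hXt
  -- the datum record
  obtain ⟨hfg₀, htors₀, hμ₀, hlam₀, -⟩ := h23 W p hp2 κ hκ γ hγ L hC hfix S₀ hS₀
    (datumDualData W κ L ∅ hγ) (datumDualData W κ L ↑S₀ hγ) hXt
  haveI := hfg₀
  -- §4b: the dual of `S^{Σ₀}_A` over `DS.X`: f.g., torsion, `μ` equal, `λ = λ(DS) + 1`
  have hφT₀ : ∀ t : nonPrimitiveSelmerInfty W κ (↑S₀ : Set (HeightOneSpectrum (𝓞 ℚ))),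
      ((NonPrimitiveSelmerDual.conjNonPrimitive W κ _ γ t : nonPrimitiveSelmerInfty W κ _) :
        subgroupH1 κ.kerSubgroup (W.geomPrimaryTorsion p)) =
          conjH1 κ.kerSubgroup (W.geomPrimaryTorsion p) γ t :=
    fun t ↦ rfl
  obtain ⟨hfgS, htorsS, hμS, hlamS⟩ := invariants_of_restrictionMap W κ hγ L ↑S₀ hTS₀
    (NonPrimitiveSelmerDual.conjNonPrimitive W κ _ γ) hφT₀
    (NonPrimitiveSelmerDual.isLocNil_conjNonPrimitive_sub_one W κ _ hγ) DS.toDual DS.bijective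
    (fun y t ↦ DS.toDual_T_smul y t) DS.toDual_C_smul htors₀
  refine ⟨hfgS, htorsS, ?_, ?_⟩
  · rw [← hμS, hμ₀, hμ]
  · rw [hc₀] at hlamS
    rw [hcE] at hlam
    have h := hlam₀
    rw [hlamS, hlam] at h
    omega

end Split

end Summit.BirchSwinnertonDyer.Rank1Residual.X2.NonPrimitiveLambdaInvariantSplitOfDatum

end
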